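import Literature.MathematicalPhysics.QuantumFieldTheory.Balaban1983to89.B11Eq63V0GroupCurrent
import Literature.MathematicalPhysics.QuantumFieldTheory.Balaban1983to89.B11Ineq73KernelLettersPerLattice

/-!
# `Balaban1983to89.B11Eq98V0LettersPerLattice` — T. Bałaban, *The variational problem and background fields in renormalization group method for
# lattice gauge theories*, Commun. Math. Phys. **102** (1985) 277–309 [Balaban1985Variational]: (90)–(96) pp. 291–292 (the V₀-group of `(δ/δA′)V`),
# (38) p. 284, (14) p. 280, (98) p. 293 — THE PER-LATTICE LETTERS OF THE V₀-GROUP's (98)-SLOT EXIST: the level-geometry letter `Λ` and the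
# (38)-trace letter `K` displayed by `B11Eq63V0GroupCurrent.quadAnalytic_curV0` are INHABITED at every fixed lattice and every background, so
# `∃ C_V ≥ 0, QuadAnalytic (curV0 ρ τ U₀) C_V (1/16)` holds from the structural hypotheses alone

statement-level skeleton of published theorems with citation tags; proofs where landed; nothing here is a claim about the Yang–Mills mass gap

PDF held: `paper:balaban1985-cmp102-variational-background` (journal page = PDF page + 276); pp. 286–293 read by this seat in the held text layer
(p0011, p0014–p0017; 2026-08-21/22).

THE PRINT (verbatim).  p. 291 (90): *«(δ/δA′(b))V′₀(A′ − HD(A′)) = Σ_{p∈st(b)}((∂/∂A(b))V′₀)(A′ − HD(A′), ∂p) − … where st(b) denotes a set of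
plaquettes p such that b ⊂ ∂p. The derivative ((∂/∂A(b))V′₀)(A, ∂p) satisfies a bound similar to the bound (40) for the function V′₀(A, ∂p), but
with the power of |A| lower by 1, and with a different absolute constant.»*; p. 293, Prop. 4: *«The constants a₃, C₄ depend on d and L only.»*
WHAT IS PROVED is NOT that uniformity: it is the PER-LATTICE existence of the two constants the crew's V₀-group file displays.

WHY THIS FILE (cell context).  ne9-leaf-05 g64's `B11Eq63V0GroupCurrent.quadAnalytic_curV0` proves the `Regime.quad` slot «W for the V₀ term of
(80)» — `QuadAnalytic (curV0 ρ τ U₀) (1024(d−1)Λ³‖ρ‖(K + 1/16) + (d−1)Λ³(136 + 2Λ)‖ρ‖‖τ‖) (1/16)` — under DISPLAYED letters: `Λ ≥ 1` with three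
level-geometry inequalities `hΛ`, `hΛa`, `hΛ'` between the weights `(L^{lev}η)ⁿ` of adjacent bonds ∕ plaquettes, and `K ≥ 0` with the (38)-type trace
slots `hRe1`, `hIm` of the background's plaquette variables.  g71's X-read (C-ne9leaf01g71-4 INFO-1) recorded «the one missing brick towards a
display-free QuadAnalytic curComm = a supplier levels_adjacent ⇒ hΛ ∧ hΛa ∧ hΛ'», nobody's INTENT.  Here: on a FINITE lattice both letters
EXIST outright — `Λ` as a finite maximum of ratios of positive weights (any level maps), `K` as `‖τ‖` times a finite maximum over the plaquettes
(any background) —, so the slot holds per lattice from structure alone; the companion `B11Ineq73KernelLettersPerLattice` (this lineage) does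
the same for the kernel-column letters `θ_E`, `θ₃` of the Sect. D groups.

WHAT IS PROVED (sorry-free; no definition; no `Prop` placeholder; nothing of [B11]'s inequalities asserted).
* §0 `exists_ratio_bound` — on a finite index type, `g > 0` pointwise ⇒ `∃ Λ ≥ 1, ∀ i, f i ≤ Λ·g i` ([folklore]; `Λ = max 1 (Σ |f i|/g i)`).
* §1 **`exists_levelGeometry`** — `∃ Λ ≥ 1` with `hΛ`, `hΛa`, `hΛ'` of `quadAnalytic_curV0` VERBATIM, for ANY `lev₀`, `lev₁` (`levWeight_pos`, `plaqWeight_pos`).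
* §2 **`exists_traceSlotK`** — for ANY background `U₀`: `∃ K ≥ 0` with `hRe1`, `hIm` VERBATIM (`norm_mul_le`, `τ.le_opNorm`).
* §3 **`exists_quadAnalytic_curV0`** — g64's theorem FED: under `hU` (unitary), `hUn`, `hτ` (tracial), `hτs`, `1 ≤ L`, the (31) slots `hW`, `hW'`,
  `[NormOneClass 𝔸]` ONLY: `∃ C_V ≥ 0, QuadAnalytic (curV0 ρ τ U₀) C_V (1/16)` at `Dc := nabla115 η U₀`.
* §4 **`exists_quadAnalytic_W80_structural`** — the companion's §5 `exists_quadAnalytic_W80` with `hqV` DISCHARGED by §3: for ANY `J`, `Δπ`, under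
  `RC : Regime H 0 C b 0 C₂ c₄ 0 a_C ε_C`, `hC : Prop4Hyp C C₂ c₄`, `0 < a_C` and structure ONLY: `∃ R′ > 0, ∃ C₄ ≥ 0, QuadAnalytic (W80 ρ τ U₀ H C ε_C J Δπ)
  C₄ R′ ∧ AnalyticOnNhd …` — the `Wq`-slot binders of `cur_chart_exists_of_W_H126` ∕ `cur_chart_exists_of_small_field` for `Wq := W80 …`, per lattice.
HONEST SCOPE.  (i) PER-LATTICE constants only: `Λ` counts the worst weight ratio of ONE lattice's level maps, `K` the worst plaquette of ONE background
— NO adjacency structure, NO (38)∕(14) smallness derived, NO «d and L only».  (ii) `hW`∕`hW'` (`‖τ(Z·∂U₀)‖ ≤ ‖Z‖`: normalised trace on unitaries) and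
`hUn` stay hypotheses — structural, not per-lattice letters.  (iii) NOT summit progress (cell pub-balaban: NE9 NOT PRINTED / NOT PROVED; «NE9 ⇐ the
named binders»; spine PROVED 0/9; HONEST DEPENDENCY: continuum YM on T⁴ ⇐ BetaPertH ∧ nine spine estimates (0/9 proved); BetaPertH ⇐ (D1) ∧ (D4) ∧
CAP+tail; G-an2-4 gates asym, D1 and NE2/3/4).  Filed by the NE9 leaf seat `b2b-balaban-t4-ne9-formalise-leaf-01` (gen 73); NEW file; imports
`B11Eq63V0GroupCurrent` + this lineage's `B11Ineq73KernelLettersPerLattice` (p313303); nothing modified.  Net new unproved facts: 0.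
-/

noncomputable section

open scoped BigOperators
namespace Literature.MathematicalPhysics.QuantumFieldTheory.Balaban1983to89.B11Eq98V0LettersPerLattice

open Literature.MathematicalPhysics.QuantumFieldTheory.Balaban1983to89.B9Eq37Insertion (reC imC)
open Literature.MathematicalPhysics.QuantumFieldTheory.Balaban1983to89.B9Eq39Adjoint (posPlaq plaqU)
open Literature.MathematicalPhysics.QuantumFieldTheory.Balaban1983to89.B11Eq90StB (st)
open Literature.MathematicalPhysics.QuantumFieldTheory.Balaban1983to89.B11Eq90V0primeBond (plaqWeight plaqWeight_pos)
open Literature.MathematicalPhysics.QuantumFieldTheory.Balaban1983to89.B11Eq90V0primeCurrent (Tsh Ucur)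
open Literature.MathematicalPhysics.QuantumFieldTheory.Balaban1983to89.B11Eq63V0GroupCurrent (curV0 quadAnalytic_curV0)
open Literature.MathematicalPhysics.QuantumFieldTheory.Balaban1983to89.B11Prop6Scheme (Prop4Hyp)
open Literature.MathematicalPhysics.QuantumFieldTheory.Balaban1983to89.B13Contraction113 (QuadAnalytic)
open Literature.MathematicalPhysics.QuantumFieldTheory.Balaban1983to89.B11Eq174Chart (Regime)
open Literature.MathematicalPhysics.QuantumFieldTheory.Balaban1983to89.B11Eq80Current (W80)
open Literature.MathematicalPhysics.QuantumFieldTheory.Balaban1983to89.B11Ineq73KernelLettersPerLattice (exists_quadAnalytic_W80)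
open B9SectCLatticeCarrier (Bond)
open B4Sect5Torus (TSite)
open B11Eq115Space
open B11Eq111FrakG (nabla115)

/-! ## §0 A finite family of ratios has a common bound -/

/-- On a finite index type, if `g > 0` pointwise then `f ≤ Λ·g` for one `Λ ≥ 1` (`Λ = max 1 (Σ_i |f i|/g i)`). [folklore]
[cite: Balaban1985Variational, (90) p.291] -/
theorem exists_ratio_bound {ι : Type*} [Finite ι] (f g : ι → ℝ) (hg : ∀ i, 0 < g i) : ∃ Λ : ℝ, 1 ≤ Λ ∧ ∀ i, f i ≤ Λ * g i := by
  classical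
  haveI := Fintype.ofFinite ι
  refine ⟨max 1 (∑ i, |f i| / g i), le_max_left _ _, fun i => ?_⟩
  have hterm : ∀ j, 0 ≤ |f j| / g j := fun j => div_nonneg (abs_nonneg _) (hg j).le
  calc f i ≤ |f i| := le_abs_self _
    _ = |f i| / g i * g i := by rw [div_mul_cancel₀ _ (hg i).ne']
    _ ≤ (∑ j, |f j| / g j) * g i :=
        mul_le_mul_of_nonneg_right (Finset.single_le_sum (f := fun j => |f j| / g j) (fun j _ => hterm j) (Finset.mem_univ i)) (hg i).le
    _ ≤ max 1 (∑ j, |f j| / g j) * g i := mul_le_mul_of_nonneg_right (le_max_right _ _) (hg i).le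

/-! ## §1 The level-geometry letter `Λ` exists on a finite lattice -/

variable {d : ℕ} {Pd : Fin d → ℕ} {L η : ℝ} [Fact (0 < L)] [Fact (0 < η)]

/-- **THE THREE LEVEL-GEOMETRY DISPLAYS OF `quadAnalytic_curV0` ARE INHABITED PER LATTICE**: for ANY level maps `lev₀` (bonds) and `lev₁` (bond pairs)
there is `Λ ≥ 1` with `w₁(x₀, μ₀) ≤ Λ·w_∂(q)` (all `q`, `μ₀`, `x₀`), `w₁(x₀, μ₀) ≤ Λ·w₁(y, μ₀) ∧ w₁(x₀, μ₀) ≤ Λ·w₁(y, ν)` and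
`w₁(x₀, μ₀)² ≤ Λ²·w₂((y, κ), κ″)` (all indices) — a finite maximum of ratios of positive weights (`levWeight_pos`, `plaqWeight_pos`); the membership
side conditions of the displays are not even needed. [cite: Balaban1985Variational, (90)–(96) pp.291–292, (98) p.293] -/
theorem exists_levelGeometry (lev₀ : Bond d Pd → ℕ) (lev₁ : Bond d Pd × Fin d → ℕ) :
    ∃ Λ : ℝ, 1 ≤ Λ ∧
      (∀ q ∈ posPlaq (TSite d Pd) (Fin d), ∀ (μ₀ : Fin d) (x₀ : TSite d Pd), q ∈ st Tsh μ₀ x₀ →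
        levWeight L η lev₀ 1 (x₀, μ₀) ≤ Λ * plaqWeight Tsh (levWeight L η lev₀ 1) q) ∧
      (∀ (x₀ : TSite d Pd) (μ₀ ν : Fin d) (y : TSite d Pd), (y = x₀ ∨ y = (Tsh ν).symm x₀) →
        levWeight L η lev₀ 1 (x₀, μ₀) ≤ Λ * levWeight L η lev₀ 1 (y, μ₀) ∧
          levWeight L η lev₀ 1 (x₀, μ₀) ≤ Λ * levWeight L η lev₀ 1 (y, ν)) ∧
      (∀ (x₀ : TSite d Pd) (μ₀ ν : Fin d) (y : TSite d Pd), (y = x₀ ∨ y = (Tsh ν).symm x₀) →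
        ∀ κ κ'' : Fin d, (κ = μ₀ ∨ κ = ν) → (κ'' = μ₀ ∨ κ'' = ν) →
          levWeight L η lev₀ 1 (x₀, μ₀) ^ 2 ≤ Λ ^ 2 * levWeight L η lev₁ 2 ((y, κ), κ'')) := by
  have hw : ∀ b : Bond d Pd, 0 < levWeight L η lev₀ 1 b := levWeight_pos (Fact.out : 0 < L) (Fact.out : 0 < η) lev₀ 1
  have hw2 : ∀ b : Bond d Pd × Fin d, 0 < levWeight L η lev₁ 2 b := levWeight_pos (Fact.out : 0 < L) (Fact.out : 0 < η) lev₁ 2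
  have hpw : ∀ q, 0 < plaqWeight Tsh (levWeight L η lev₀ 1) q := plaqWeight_pos Tsh hw
  -- family 1: plaquette weights
  obtain ⟨Λ₁, hΛ₁, h₁⟩ := exists_ratio_bound (ι := (TSite d Pd × Fin d × Fin d) × Fin d × TSite d Pd)
    (fun i => levWeight L η lev₀ 1 (i.2.2, i.2.1)) (fun i => plaqWeight Tsh (levWeight L η lev₀ 1) i.1) (fun i => hpw i.1)
  -- family 2: bond weights
  obtain ⟨Λ₂, hΛ₂, h₂⟩ := exists_ratio_bound (ι := (TSite d Pd × Fin d) × (TSite d Pd × Fin d))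
    (fun i => levWeight L η lev₀ 1 i.1) (fun i => levWeight L η lev₀ 1 i.2) (fun i => hw i.2)
  -- family 3: squared bond weights against pair weights
  obtain ⟨Λ₃, hΛ₃, h₃⟩ := exists_ratio_bound (ι := (TSite d Pd × Fin d) × (Bond d Pd × Fin d))
    (fun i => levWeight L η lev₀ 1 i.1 ^ 2) (fun i => levWeight L η lev₁ 2 i.2) (fun i => hw2 i.2)
  refine ⟨max Λ₁ (max Λ₂ Λ₃), le_max_of_le_left hΛ₁, ?_, ?_, ?_⟩
  · intro q _ μ₀ x₀ _
    exact (h₁ (q, μ₀, x₀)).trans (mul_le_mul_of_nonneg_right (le_max_left _ _) (hpw q).le)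
  · intro x₀ μ₀ ν y _
    have hm : Λ₂ ≤ max Λ₁ (max Λ₂ Λ₃) := le_max_of_le_right (le_max_left _ _)
    exact ⟨(h₂ ((x₀, μ₀), (y, μ₀))).trans (mul_le_mul_of_nonneg_right hm (hw _).le),
      (h₂ ((x₀, μ₀), (y, ν))).trans (mul_le_mul_of_nonneg_right hm (hw _).le)⟩
  · intro x₀ μ₀ ν y _ κ κ'' _ _
    have hm : Λ₃ ≤ max Λ₁ (max Λ₂ Λ₃) := le_max_of_le_right (le_max_right _ _)
    have hM1 : 1 ≤ max Λ₁ (max Λ₂ Λ₃) := le_max_of_le_left hΛ₁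
    calc levWeight L η lev₀ 1 (x₀, μ₀) ^ 2 ≤ Λ₃ * levWeight L η lev₁ 2 ((y, κ), κ'') := h₃ ((x₀, μ₀), ((y, κ), κ''))
      _ ≤ max Λ₁ (max Λ₂ Λ₃) * levWeight L η lev₁ 2 ((y, κ), κ'') := mul_le_mul_of_nonneg_right hm (hw2 _).le
      _ ≤ max Λ₁ (max Λ₂ Λ₃) ^ 2 * levWeight L η lev₁ 2 ((y, κ), κ'') := by
          refine mul_le_mul_of_nonneg_right ?_ (hw2 _).le
          nlinarith

/-! ## §2 The (38)-trace letter `K` exists for every background on a finite lattice -/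

variable {𝔸 : Type*} [NormedRing 𝔸] [NormedAlgebra ℂ 𝔸]

/-- **THE (38)-TYPE TRACE SLOTS OF `quadAnalytic_curV0` ARE INHABITED PER LATTICE, FOR EVERY BACKGROUND**: `∃ K ≥ 0` with
`‖τ(Z·(Re ∂U₀(q) − 1))‖ ≤ ‖Z‖·η²·K/w_∂(q)²` and `‖τ(Z·η⁻²Im ∂U₀(q))‖ ≤ ‖Z‖·K/w_∂(q)²` on the positively oriented plaquettes — `K = ‖τ‖·`(a finite
maximum over the plaquettes of ONE background); print's (38)/(14) make `K` SMALL and uniform, which is NOT derived here.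
[cite: Balaban1985Variational, (38) p.284, (14) p.280, (90) p.291] -/
theorem exists_traceSlotK (τ : 𝔸 →L[ℂ] ℂ) (lev₀ : Bond d Pd → ℕ) (U₀ : Bond d Pd → 𝔸ˣ) :
    ∃ K : ℝ, 0 ≤ K ∧
      (∀ q ∈ posPlaq (TSite d Pd) (Fin d), ∀ Z : 𝔸,
        ‖(τ : 𝔸 →ₗ[ℂ] ℂ) (Z * (reC (plaqU Tsh (Ucur U₀) q.2.1 q.2.2 q.1) - 1))‖
          ≤ ‖Z‖ * (η ^ 2 * (K / plaqWeight Tsh (levWeight L η lev₀ 1) q ^ 2))) ∧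
      (∀ q ∈ posPlaq (TSite d Pd) (Fin d), ∀ Z : 𝔸,
        ‖(τ : 𝔸 →ₗ[ℂ] ℂ) (Z * (((η : ℂ) ^ 2)⁻¹ • imC (plaqU Tsh (Ucur U₀) q.2.1 q.2.2 q.1)))‖
          ≤ ‖Z‖ * (K / plaqWeight Tsh (levWeight L η lev₀ 1) q ^ 2)) := by
  have hη : (0 : ℝ) < η := Fact.out
  have hw : ∀ b : Bond d Pd, 0 < levWeight L η lev₀ 1 b := levWeight_pos (Fact.out : 0 < L) hη lev₀ 1
  have hpw : ∀ q, 0 < plaqWeight Tsh (levWeight L η lev₀ 1) q := plaqWeight_pos Tsh hw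
  -- the generic estimate `‖τ(Z·X)‖ ≤ ‖τ‖·‖X‖·‖Z‖`
  have key : ∀ Z X : 𝔸, ‖(τ : 𝔸 →ₗ[ℂ] ℂ) (Z * X)‖ ≤ ‖τ‖ * ‖X‖ * ‖Z‖ := fun Z X => by
    calc ‖(τ : 𝔸 →ₗ[ℂ] ℂ) (Z * X)‖ = ‖τ (Z * X)‖ := rfl
      _ ≤ ‖τ‖ * ‖Z * X‖ := τ.le_opNorm _
      _ ≤ ‖τ‖ * (‖Z‖ * ‖X‖) := by gcongr; exact norm_mul_le _ _
      _ = ‖τ‖ * ‖X‖ * ‖Z‖ := by ring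
  obtain ⟨K₁, hK₁, h₁⟩ := exists_ratio_bound (ι := TSite d Pd × Fin d × Fin d)
    (fun q => ‖τ‖ * ‖reC (plaqU Tsh (Ucur U₀) q.2.1 q.2.2 q.1) - 1‖)
    (fun q => η ^ 2 / plaqWeight Tsh (levWeight L η lev₀ 1) q ^ 2) (fun q => by have := hpw q; positivity)
  obtain ⟨K₂, hK₂, h₂⟩ := exists_ratio_bound (ι := TSite d Pd × Fin d × Fin d)
    (fun q => ‖τ‖ * ‖((η : ℂ) ^ 2)⁻¹ • imC (plaqU Tsh (Ucur U₀) q.2.1 q.2.2 q.1)‖)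
    (fun q => 1 / plaqWeight Tsh (levWeight L η lev₀ 1) q ^ 2) (fun q => by have := hpw q; positivity)
  refine ⟨max K₁ K₂, le_max_of_le_left (zero_le_one.trans hK₁), fun q _ Z => ?_, fun q _ Z => ?_⟩
  · calc _ ≤ ‖τ‖ * ‖reC (plaqU Tsh (Ucur U₀) q.2.1 q.2.2 q.1) - 1‖ * ‖Z‖ := key Z _
      _ ≤ K₁ * (η ^ 2 / plaqWeight Tsh (levWeight L η lev₀ 1) q ^ 2) * ‖Z‖ := mul_le_mul_of_nonneg_right (h₁ q) (norm_nonneg _)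
      _ ≤ max K₁ K₂ * (η ^ 2 / plaqWeight Tsh (levWeight L η lev₀ 1) q ^ 2) * ‖Z‖ :=
          mul_le_mul_of_nonneg_right (mul_le_mul_of_nonneg_right (le_max_left _ _) (by have := hpw q; positivity)) (norm_nonneg _)
      _ = ‖Z‖ * (η ^ 2 * (max K₁ K₂ / plaqWeight Tsh (levWeight L η lev₀ 1) q ^ 2)) := by ring
  · calc _ ≤ ‖τ‖ * ‖((η : ℂ) ^ 2)⁻¹ • imC (plaqU Tsh (Ucur U₀) q.2.1 q.2.2 q.1)‖ * ‖Z‖ := key Z _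
      _ ≤ K₂ * (1 / plaqWeight Tsh (levWeight L η lev₀ 1) q ^ 2) * ‖Z‖ := mul_le_mul_of_nonneg_right (h₂ q) (norm_nonneg _)
      _ ≤ max K₁ K₂ * (1 / plaqWeight Tsh (levWeight L η lev₀ 1) q ^ 2) * ‖Z‖ :=
          mul_le_mul_of_nonneg_right (mul_le_mul_of_nonneg_right (le_max_right _ _) (by have := hpw q; positivity)) (norm_nonneg _)
      _ = ‖Z‖ * (max K₁ K₂ / plaqWeight Tsh (levWeight L η lev₀ 1) q ^ 2) := by ring

/-! ## §3 The V₀-group's (98)-slot holds per lattice from structure alone -/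

/-- **`∃ C_V ≥ 0, QuadAnalytic (curV0 ρ τ U₀) C_V (1/16)` AT EVERY FIXED LATTICE** — g64's `quadAnalytic_curV0` with its letters `Λ` (§1) and `K` (§2)
SUPPLIED; the remaining hypotheses are structural: `U₀` unitary with `‖U₀(b)‖, ‖U₀(b)⁻¹‖ ≤ 1`, `τ` a tracial `*`-trace with the (31) slots
`‖τ(Z·∂U₀(q)^{±1})‖ ≤ ‖Z‖`, `1 ≤ L`. The constant `C_V` is a finite-lattice number depending on `U₀`; print's (98) has `C₄` depending on `d`, `L` only.
[cite: Balaban1985Variational, (98) p.293, (90)–(96) pp.291–292] -/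
theorem exists_quadAnalytic_curV0 {lev₀ : Bond d Pd → ℕ} {lev₁ : Bond d Pd × Fin d → ℕ} [CompleteSpace 𝔸] [NormOneClass 𝔸] [StarRing 𝔸]
    [StarModule ℂ 𝔸] (ρ : (𝔸 →L[ℂ] ℂ) →L[ℂ] 𝔸) (τ : 𝔸 →L[ℂ] ℂ) (U₀ : Bond d Pd → 𝔸ˣ)
    (hU : ∀ b, (((U₀ b)⁻¹ : 𝔸ˣ) : 𝔸) = star (U₀ b : 𝔸))
    (hUn : ∀ b, ‖(U₀ b : 𝔸)‖ ≤ 1 ∧ ‖(((U₀ b)⁻¹ : 𝔸ˣ) : 𝔸)‖ ≤ 1)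
    (hτ : ∀ a b : 𝔸, τ (a * b) = τ (b * a)) (hτs : ∀ a : 𝔸, τ (star a) = starRingEnd ℂ (τ a)) (hL : 1 ≤ L)
    (hW : ∀ q ∈ posPlaq (TSite d Pd) (Fin d), ∀ Z : 𝔸,
      ‖(τ : 𝔸 →ₗ[ℂ] ℂ) (Z * (plaqU Tsh (Ucur U₀) q.2.1 q.2.2 q.1 : 𝔸))‖ ≤ ‖Z‖)
    (hW' : ∀ q ∈ posPlaq (TSite d Pd) (Fin d), ∀ Z : 𝔸,
      ‖(τ : 𝔸 →ₗ[ℂ] ℂ) (Z * (((plaqU Tsh (Ucur U₀) q.2.1 q.2.2 q.1)⁻¹ : 𝔸ˣ) : 𝔸))‖ ≤ ‖Z‖) :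
    ∃ CV : ℝ, 0 ≤ CV ∧
      B13Contraction113.QuadAnalytic (curV0 (L := L) (η := η) (lev₀ := lev₀) (lev₁ := lev₁) (Dc := nabla115 η U₀) ρ τ U₀) CV (1 / 16) := by
  obtain ⟨Λ, hΛ1, hΛ, hΛa, hΛ'⟩ := exists_levelGeometry (L := L) (η := η) lev₀ lev₁
  obtain ⟨K, hK, hRe1, hIm⟩ := exists_traceSlotK (L := L) (η := η) τ lev₀ U₀
  refine ⟨_, ?_, quadAnalytic_curV0 ρ τ U₀ hU hUn hτ hτs hL hK hΛ1 hΛ hΛa hΛ' hRe1 hIm hW hW'⟩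
  have hΛ0 : 0 ≤ Λ := zero_le_one.trans hΛ1
  positivity

/-! ## §4 The W-slot of the NE9 chart for `W80`, per lattice, from the regime and structure alone -/

/-- **THE `Wq`-SLOT BINDERS OF `cur_chart_exists_of_W_H126` ∕ `cur_chart_exists_of_small_field` FOR `Wq := W80 …`, AS A THEOREM PER LATTICE**: for ANY
letters `J`, `Δπ`, under the Sect. C regime `RC`, `C` of Prop.-4 type, `0 < a_C` and the structural hypotheses of §3: `∃ R′ > 0, ∃ C₄ ≥ 0,
QuadAnalytic (W80 ρ τ U₀ H C ε_C J Δπ) C₄ R′ ∧ AnalyticOnNhd ℂ (W80 …) {‖Y‖ < R′}` (the companion's `exists_quadAnalytic_W80` with `hqV := §3`).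
[cite: Balaban1985Variational, Prop. 4 (97)–(98) pp.292–293] -/
theorem exists_quadAnalytic_W80_structural {lev₀ : Bond d Pd → ℕ} {lev₁ : Bond d Pd × Fin d → ℕ} [FiniteDimensional ℂ 𝔸] [CompleteSpace 𝔸]
    [NormOneClass 𝔸] [StarRing 𝔸] [StarModule ℂ 𝔸] {𝒳 : Type*} [NormedAddCommGroup 𝒳] [NormedSpace ℂ 𝒳] [CompleteSpace 𝒳]
    (ρ : (𝔸 →L[ℂ] ℂ) →L[ℂ] 𝔸) (τ : 𝔸 →L[ℂ] ℂ) (U₀ : Bond d Pd → 𝔸ˣ)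
    (hU : ∀ b, (((U₀ b)⁻¹ : 𝔸ˣ) : 𝔸) = star (U₀ b : 𝔸))
    (hUn : ∀ b, ‖(U₀ b : 𝔸)‖ ≤ 1 ∧ ‖(((U₀ b)⁻¹ : 𝔸ˣ) : 𝔸)‖ ≤ 1)
    (hτ : ∀ a b : 𝔸, τ (a * b) = τ (b * a)) (hτs : ∀ a : 𝔸, τ (star a) = starRingEnd ℂ (τ a)) (hL : 1 ≤ L)
    (hW : ∀ q ∈ posPlaq (TSite d Pd) (Fin d), ∀ Z : 𝔸,
      ‖(τ : 𝔸 →ₗ[ℂ] ℂ) (Z * (plaqU Tsh (Ucur U₀) q.2.1 q.2.2 q.1 : 𝔸))‖ ≤ ‖Z‖)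
    (hW' : ∀ q ∈ posPlaq (TSite d Pd) (Fin d), ∀ Z : 𝔸,
      ‖(τ : 𝔸 →ₗ[ℂ] ℂ) (Z * (((plaqU Tsh (Ucur U₀) q.2.1 q.2.2 q.1)⁻¹ : 𝔸ˣ) : 𝔸))‖ ≤ ‖Z‖)
    {H : 𝒳 →L[ℂ] Space115 L η lev₀ lev₁ (nabla115 η U₀)} {C : Space115 L η lev₀ lev₁ (nabla115 η U₀) → 𝒳} {b C₂ c₄ aC εC : ℝ}
    (RC : Regime H 0 C b 0 C₂ c₄ 0 aC εC) (hC : Prop4Hyp C C₂ c₄) (haC : 0 < aC) (J : NegSize L η lev₀ 3 𝔸)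
    (Δπ : Space115 L η lev₀ lev₁ (nabla115 η U₀) →L[ℂ] NegSize L η lev₀ 3 𝔸) :
    ∃ R' : ℝ, 0 < R' ∧ ∃ C₄ : ℝ, 0 ≤ C₄ ∧ QuadAnalytic (W80 ρ τ U₀ H C εC J Δπ) C₄ R' ∧
      AnalyticOnNhd ℂ (W80 ρ τ U₀ H C εC J Δπ) {Y : Space115 L η lev₀ lev₁ (nabla115 η U₀) | ‖Y‖ < R'} := by
  obtain ⟨CV, hCV, hq⟩ := exists_quadAnalytic_curV0 (L := L) (η := η) (lev₀ := lev₀) (lev₁ := lev₁) ρ τ U₀ hU hUn hτ hτs hL hW hW'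
  exact exists_quadAnalytic_W80 ρ τ U₀ hCV (by norm_num : (0:ℝ) < 1 / 16) (fun Y hY => hq.quad Y hY) RC hC haC J Δπ

end Literature.MathematicalPhysics.QuantumFieldTheory.Balaban1983to89.B11Eq98V0LettersPerLattice

end
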